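import Summits.HodgeConjecture.CorCM.Census.CyclicCharacterEvenLowerRule

/-!
# Cyclic characters, XXXVII: EVEN KERNEL, `d = 0` — THE ODD-STABILISED BALANCED TYPE and the corners of its owned face (`k = 2`)

COR-CM (cell `pub-hodgecm2`), count-neutral kernel combinatorics by the binder seat b09 (gen 44; lane CYCLIC-CHARACTER FIBRE LAW, part XXXVII), on parts
XXXIV–XXXVI BY NAME.  Theorems only (no definition, no `decide`
beyond numerals of `ℤ/4`, no certificate, no named fact, no `sorry`).  HONEST FRAMING: `HC_CM` is NOT proved, here or anywhere in the tree; nothing here is a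
period or a headline.

`d = 0` means: some `g` with `w g` odd is not a root of `c` (`c ∉ ⟨g⟩`); replacing `g` by `g⁻¹` if needed, `w g = 1`.
* §1 a type fixed by `g` exists by lit-andre-3ʼs `Census/TypeStabiliserSubgroup.exists_rt_eq_of_notMem_zpowers` (`c ∉ ⟨g⟩`; used BY NAME in part XXXIX);
  here only the normalisation `w g = 1` of the `d = 0` witness.
* §2 transport of membership along the stabiliser (`P ∈ Ψ ↔ P·g ∈ Ψ ↔ P·g⁻¹ ∈ Ψ`), and by part XXXIV such a `Ψ` is BALANCED: `x_0(Ψ) = x_1(Ψ) = m`,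
  potential `n` (far, and outside every two-way tie block).
* §3 **THE OWNED FACE** `gface Ψ s t'` with `s ∈ F_0 ∩ Ψ` and `t' ∈ F_1 ∖ Ψ` (a face toward `T_1 = T_0·g`: both places are `T_1`-deviation places) and its
  three corners in lower-left position: `X₁ = Ψ^{(t')}` (`x = (m, m−1)`), and `Ψ^{(s)} = Y₂·g`, `Ψ^{(s t')} = Y₃·g` with `Y₂ = Ψ^{(v_s)}`, `Y₃ = Ψ^{(b')(v_s)}`
  (`v_s = c·s·g⁻¹ ∈ F_1 ∖ Ψ`, `b' = t'·g⁻¹ ∈ F_0 ∖ Ψ`; coordinates `(m, m−1)` and `(m−1, m−1)`) — so part XXXVʼs canonical linearisation applies to all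
  three (two of them after transport by `g⁻¹`, whose base change carries `T_0` to `T_1`).
* §4 the elements of the relation: `s_{t'} = c·t'·g ∈ F_0 ∩ Ψ`, `ν = c·g⁻² ∈ ker w` with `g⁻¹·g⁻¹ = c·ν` and `b'·ν⁻¹ = s_{t'}`; and the two REINDEXING
  BIJECTIONS of the bottom/top deviations `B = F_0 ∖ Ψ`, `V = F_1 ∖ Ψ`: `B·g = V` and `c·(V ∖ t')·g = (F_0 ∩ Ψ) ∖ s_{t'}`.
Part XXXVIII turns the owned face into the relation `R(B ∪ {s_{t'}}) ∈ L`.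

## References
* [Pohlmann1968] H. Pohlmann, Algebraic cycles on abelian varieties of complex multiplication type, Ann. of Math. 88 (1968), Thm 1.
-/

namespace Summit.HodgeConjecture.CorCM.Census.CyclicCharacter

open Finset
open Summit.HodgeConjecture.CorCM.Prior.AllgGroup.RfwfAllgGroup
open Summit.HodgeConjecture.CorCM.Census.BlockParity
open Summit.HodgeConjecture.CorCM.Census.Coinvariant
open Summit.HodgeConjecture.CorCM.Census.TwistGeneration
open Summit.HodgeConjecture.CorCM.Census.BaseBlock

noncomputable section

variable {G : Type*} [Group G] [Fintype G] [DecidableEq G] {k : ℕ} {w : G → ZMod (2 ^ k)} {c : G}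

/-! ## §1 A non-root with `w g = 1` (the fixed type itself is lit-andre-3ʼs `TypeStabiliser.exists_rt_eq_of_notMem_zpowers`) -/

omit [Fintype G] [DecidableEq G] in
/-- **A NON-ROOT WITH `w g = 1`**: if some `g` with `w g` odd has `c ∉ ⟨g⟩`, then some `g` with `w g = 1` has `c ∉ ⟨g⟩` (`k = 2`; take `g` or `g⁻¹`). [folklore] -/
theorem exists_apply_eq_one_notMem_zpowers (hw : ∀ P Q : G, w (P * Q) = w P + w Q) (hk2 : k = 2)
    (hnon : ∃ g : G, ¬ 2 ∣ (w g).val ∧ c ∉ Subgroup.zpowers g) : ∃ g : G, w g = 1 ∧ c ∉ Subgroup.zpowers g := by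
  obtain ⟨g, hodd, hg⟩ := hnon
  have h13 : w g = 1 ∨ w g = 3 := by
    have key : ∀ u : ZMod (2 ^ k), ¬ 2 ∣ u.val → u = 1 ∨ u = 3 := by subst hk2; decide
    exact key _ hodd
  rcases h13 with h | h
  · exact ⟨g, h, hg⟩
  · refine ⟨g⁻¹, by rw [map_inv hw, h]; subst hk2; decide, by rwa [Subgroup.zpowers_inv]⟩

/-! ## §2 Membership transport along the stabiliser; balance -/

/-- `P ∈ Ψ ↔ P·g ∈ Ψ` for a type fixed by `g`. [folklore] -/
theorem mem_iff_mul_mem_of_rt_eq {Ψ : CMF G c} {g : G} (hΨ : rt c g Ψ = Ψ) (P : G) : P ∈ Ψ.1 ↔ P * g ∈ Ψ.1 := by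
  rw [← mem_rt c g Ψ P, hΨ]

/-- `P·g⁻¹ ∈ Ψ ↔ P ∈ Ψ` for a type fixed by `g`. [folklore] -/
theorem mul_inv_mem_iff_of_rt_eq {Ψ : CMF G c} {g : G} (hΨ : rt c g Ψ = Ψ) (P : G) : P * g⁻¹ ∈ Ψ.1 ↔ P ∈ Ψ.1 := by
  rw [mem_iff_mul_mem_of_rt_eq hΨ (P * g⁻¹), inv_mul_cancel_right]

/-- A type fixed by `g` is fixed by `g⁻¹`. [folklore] -/
theorem rt_inv_eq_self_of_rt_eq {Ψ : CMF G c} {g : G} (hΨ : rt c g Ψ = Ψ) : rt c g⁻¹ Ψ = Ψ := by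
  conv_lhs => rw [← hΨ]
  rw [rt_inv_rt]

/-- `c·P ∈ Ψ ↔ P ∉ Ψ` (CM property). [folklore] -/
theorem cmul_mem_iff (Ψ : CMF G c) (P : G) : c * P ∈ Ψ.1 ↔ P ∉ Ψ.1 := by
  have := Ψ.2 P; tauto

/-- **A type fixed by `g` with `w g = 1` is BALANCED and FAR**: `x_0 = x_1 = m`, potential `n` (`k = 2`, `n = 2m ≥ 4`). [folklore] -/
theorem balanced_of_rt_eq (hw : ∀ P Q : G, w (P * Q) = w P + w Q) (hk : 1 ≤ k) (hk2 : k = 2) (hc2 : c * c = 1) (hwc : w c ≠ 0)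
    (h1 : ∃ g₁ : G, w g₁ = 1) {m : ℕ} (hm : 2 * m = (univ.filter fun s : G => w s = 0).card) {Ψ : CMF G c} {g : G} (hΨ : rt c g Ψ = Ψ)
    (hg : w g = 1) :
    ((univ.filter fun s : G => w s = 0) \ Ψ.1).card = m ∧ ((univ.filter fun s : G => w s = 1) \ Ψ.1).card = m ∧
      bpot c (arcType hw hk hc2 hwc 0) Ψ = (univ.filter fun s : G => w s = 0).card := by
  have hg0 : w g ≠ 0 := by
    rw [hg]; haveI : Fact (1 < 2 ^ k) := ⟨Nat.one_lt_two_pow (by omega)⟩; exact one_ne_zero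
  obtain ⟨hb, hv⟩ := card_fib_sdiff_eq_half_of_rt_eq hw hk hk2 hc2 hwc h1 hΨ hg0
  exact ⟨by omega, by omega, bpot_eq_card_ker_of_rt_eq hw hk hk2 hc2 hwc h1 hΨ hg0⟩

/-! ## §3 The owned face and its corners -/

/-- **The element `b' = t'·g⁻¹`** of a top deviation point `t' ∈ F_1 ∖ Ψ`: a bottom deviation point (`w b' = 0`, `b' ∉ Ψ`). [folklore] -/
theorem bprime_spec (hw : ∀ P Q : G, w (P * Q) = w P + w Q) {Ψ : CMF G c} {g : G} (hΨ : rt c g Ψ = Ψ) (hg : w g = 1)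
    {t' : G} (ht'1 : w t' = 1) (ht'Ψ : t' ∉ Ψ.1) : w (t' * g⁻¹) = 0 ∧ t' * g⁻¹ ∉ Ψ.1 := by
  refine ⟨by rw [hw, map_inv hw, ht'1, hg, add_neg_cancel], fun h => ht'Ψ ((mul_inv_mem_iff_of_rt_eq hΨ t').mp h)⟩

/-- **The element `v_s = c·s·g⁻¹`** of a bottom point `s ∈ F_0 ∩ Ψ`: a top deviation point (`w v_s = 1`, `v_s ∉ Ψ`) (`k = 2`). [folklore] -/
theorem vs_spec (hw : ∀ P Q : G, w (P * Q) = w P + w Q) (hk : 1 ≤ k) (hk2 : k = 2) (hc2 : c * c = 1) (hwc : w c ≠ 0)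
    {Ψ : CMF G c} {g : G} (hΨ : rt c g Ψ = Ψ) (hg : w g = 1) {s : G} (hs0 : w s = 0) (hsΨ : s ∈ Ψ.1) :
    w (c * (s * g⁻¹)) = 1 ∧ c * (s * g⁻¹) ∉ Ψ.1 := by
  refine ⟨?_, fun h => ((cmul_mem_iff Ψ _).mp h) ((mul_inv_mem_iff_of_rt_eq hΨ s).mpr hsΨ)⟩
  rw [hw, hw, map_inv hw, apply_c_eq_two hw hk hk2 hc2 hwc, hs0, hg]; subst hk2; decide

/-- **The element `s_{t'} = c·t'·g`** of a top deviation point `t' ∈ F_1 ∖ Ψ`: a bottom point of `Ψ` (`w s_{t'} = 0`, `s_{t'} ∈ Ψ`) (`k = 2`). [folklore] -/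
theorem st_spec (hw : ∀ P Q : G, w (P * Q) = w P + w Q) (hk : 1 ≤ k) (hk2 : k = 2) (hc2 : c * c = 1) (hwc : w c ≠ 0)
    {Ψ : CMF G c} {g : G} (hΨ : rt c g Ψ = Ψ) (hg : w g = 1) {t' : G} (ht'1 : w t' = 1) (ht'Ψ : t' ∉ Ψ.1) :
    w (c * (t' * g)) = 0 ∧ c * (t' * g) ∈ Ψ.1 := by
  refine ⟨?_, (cmul_mem_iff Ψ _).mpr fun h => ht'Ψ ((mem_iff_mul_mem_of_rt_eq hΨ t').mpr h)⟩
  rw [hw, hw, apply_c_eq_two hw hk hk2 hc2 hwc, ht'1, hg]; subst hk2; decide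

/-- **The corner `X₁ = Ψ^{(t')}`**: deviation `(T_0 ∖ Ψ) ∖ t'`, coordinates `(m, m − 1)`. [folklore] -/
theorem corner_one_spec (hw : ∀ P Q : G, w (P * Q) = w P + w Q) (hk : 1 ≤ k) (hk2 : k = 2) (hc2 : c * c = 1) (hwc : w c ≠ 0)
    (h1 : ∃ g₁ : G, w g₁ = 1) {m : ℕ} (hm : 2 * m = (univ.filter fun s : G => w s = 0).card) {Ψ : CMF G c} {g : G} (hΨ : rt c g Ψ = Ψ)
    (hg : w g = 1) {t' : G} (ht'1 : w t' = 1) (ht'Ψ : t' ∉ Ψ.1) :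
    (arcType hw hk hc2 hwc 0).1 \ (oflipCM c hc2 t' Ψ).1 = ((arcType hw hk hc2 hwc 0).1 \ Ψ.1).erase t' ∧
    ((univ.filter fun s : G => w s = 0) \ (oflipCM c hc2 t' Ψ).1).card = m ∧
    ((univ.filter fun s : G => w s = 1) \ (oflipCM c hc2 t' Ψ).1).card + 1 = m := by
  obtain ⟨hb, hv, -⟩ := balanced_of_rt_eq hw hk hk2 hc2 hwc h1 hm hΨ hg
  have ht'T : t' ∈ (arcType hw hk hc2 hwc 0).1 := (mem_arcType_iff_of_two hw hk hk2 hc2 hwc 0 t').mpr (Or.inr (by rw [zero_add]; exact ht'1))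
  have hdev := dev_oflip c hc2 ht'T ht'Ψ
  refine ⟨hdev, ?_, ?_⟩
  · rw [fib_zero_sdiff_eq_filter hw hk hk2 hc2 hwc, hdev, filter_erase, erase_eq_of_notMem, ← fib_zero_sdiff_eq_filter hw hk hk2 hc2 hwc, hb]
    rw [mem_filter]; rintro ⟨-, h⟩; rw [ht'1] at h
    haveI : Fact (1 < 2 ^ k) := ⟨Nat.one_lt_two_pow (by omega)⟩; exact one_ne_zero h
  · rw [fib_one_sdiff_eq_filter hw hk hk2 hc2 hwc, hdev, filter_erase, card_erase_of_mem, ← fib_one_sdiff_eq_filter hw hk hk2 hc2 hwc, hv]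
    · have : 1 ≤ ((univ.filter fun s : G => w s = 1) \ Ψ.1).card :=
        card_pos.mpr ⟨t', mem_sdiff.mpr ⟨mem_filter.mpr ⟨mem_univ _, ht'1⟩, ht'Ψ⟩⟩
      omega
    · exact mem_filter.mpr ⟨mem_sdiff.mpr ⟨ht'T, ht'Ψ⟩, ht'1⟩

/-- **The corner `Ψ^{(s)} = Y₂·g`** with `Y₂ = Ψ^{(v_s)}` (`v_s = c·s·g⁻¹`): `rt g⁻¹ Y₂ = Ψ^{(s)}`, deviation of `Y₂` = `(T_0 ∖ Ψ) ∖ v_s`, coordinates `(m, m − 1)`.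
[folklore] -/
theorem corner_two_spec (hw : ∀ P Q : G, w (P * Q) = w P + w Q) (hk : 1 ≤ k) (hk2 : k = 2) (hc2 : c * c = 1) (hwc : w c ≠ 0)
    (h1 : ∃ g₁ : G, w g₁ = 1) {m : ℕ} (hm : 2 * m = (univ.filter fun s : G => w s = 0).card) {Ψ : CMF G c} {g : G} (hΨ : rt c g Ψ = Ψ)
    (hg : w g = 1) {s : G} (hs0 : w s = 0) (hsΨ : s ∈ Ψ.1) :
    rt c g⁻¹ (oflipCM c hc2 (c * (s * g⁻¹)) Ψ) = oflipCM c hc2 s Ψ ∧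
    (arcType hw hk hc2 hwc 0).1 \ (oflipCM c hc2 (c * (s * g⁻¹)) Ψ).1 = ((arcType hw hk hc2 hwc 0).1 \ Ψ.1).erase (c * (s * g⁻¹)) ∧
    ((univ.filter fun s : G => w s = 0) \ (oflipCM c hc2 (c * (s * g⁻¹)) Ψ).1).card = m ∧
    ((univ.filter fun s : G => w s = 1) \ (oflipCM c hc2 (c * (s * g⁻¹)) Ψ).1).card + 1 = m := by
  obtain ⟨hv1, hvΨ⟩ := vs_spec hw hk hk2 hc2 hwc hΨ hg hs0 hsΨ
  obtain ⟨hdev, hb, hv⟩ := corner_one_spec hw hk hk2 hc2 hwc h1 hm hΨ hg hv1 hvΨ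
  refine ⟨?_, hdev, hb, hv⟩
  rw [rt_oflipCM, rt_inv_eq_self_of_rt_eq hΨ, inv_inv, mul_assoc, inv_mul_cancel_right, oflipCM_cmul]

/-- **The corner `Ψ^{(s)(t')} = Y₃·g`** with `Y₃ = Ψ^{(v_s)(b')}`: `rt g⁻¹ Y₃ = Ψ^{(s)(t')}`, deviation `((T_0 ∖ Ψ) ∖ b') ∖ v_s`, coordinates `(m − 1, m − 1)`.
[folklore] -/
theorem corner_three_spec (hw : ∀ P Q : G, w (P * Q) = w P + w Q) (hk : 1 ≤ k) (hk2 : k = 2) (hc2 : c * c = 1) (hwc : w c ≠ 0)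
    (h1 : ∃ g₁ : G, w g₁ = 1) {m : ℕ} (hm : 2 * m = (univ.filter fun s : G => w s = 0).card) {Ψ : CMF G c} {g : G} (hΨ : rt c g Ψ = Ψ)
    (hg : w g = 1) {s t' : G} (hs0 : w s = 0) (hsΨ : s ∈ Ψ.1) (ht'1 : w t' = 1) (ht'Ψ : t' ∉ Ψ.1) :
    rt c g⁻¹ (oflipCM c hc2 (c * (s * g⁻¹)) (oflipCM c hc2 (t' * g⁻¹) Ψ)) = oflipCM c hc2 s (oflipCM c hc2 t' Ψ) ∧
    (arcType hw hk hc2 hwc 0).1 \ (oflipCM c hc2 (c * (s * g⁻¹)) (oflipCM c hc2 (t' * g⁻¹) Ψ)).1 =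
      (((arcType hw hk hc2 hwc 0).1 \ Ψ.1).erase (t' * g⁻¹)).erase (c * (s * g⁻¹)) ∧
    ((univ.filter fun s : G => w s = 0) \ (oflipCM c hc2 (c * (s * g⁻¹)) (oflipCM c hc2 (t' * g⁻¹) Ψ)).1).card + 1 = m ∧
    ((univ.filter fun s : G => w s = 1) \ (oflipCM c hc2 (c * (s * g⁻¹)) (oflipCM c hc2 (t' * g⁻¹) Ψ)).1).card + 1 = m := by
  obtain ⟨hb', hb'Ψ⟩ := bprime_spec hw hΨ hg ht'1 ht'Ψ
  obtain ⟨hv1, hvΨ⟩ := vs_spec hw hk hk2 hc2 hwc hΨ hg hs0 hsΨ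
  obtain ⟨hb, hv, -⟩ := balanced_of_rt_eq hw hk hk2 hc2 hwc h1 hm hΨ hg
  haveI : Fact (1 < 2 ^ k) := ⟨Nat.one_lt_two_pow (by omega)⟩
  have hb'T : t' * g⁻¹ ∈ (arcType hw hk hc2 hwc 0).1 := (mem_arcType_iff_of_two hw hk hk2 hc2 hwc 0 _).mpr (Or.inl hb')
  have hvT : c * (s * g⁻¹) ∈ (arcType hw hk hc2 hwc 0).1 := (mem_arcType_iff_of_two hw hk hk2 hc2 hwc 0 _).mpr (Or.inr (by rw [zero_add]; exact hv1))
  have hne : c * (s * g⁻¹) ≠ t' * g⁻¹ := fun h => by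
    have := congrArg w h; rw [hv1, hb'] at this; exact one_ne_zero this
  have hvflip : c * (s * g⁻¹) ∉ (oflipCM c hc2 (t' * g⁻¹) Ψ).1 := by
    rw [mem_oflipCM_iff' hc2, not_not, mem_orb]
    refine ⟨fun h => absurd h hvΨ, ?_⟩
    rintro (h | h)
    · exact (hne h).elim
    · exfalso
      have := congrArg w h
      rw [hv1, hw, apply_c_eq_two hw hk hk2 hc2 hwc, hb'] at this
      revert this; subst hk2; decide
  have hdev1 := dev_oflip c hc2 hb'T hb'Ψ
  have hdev2 := dev_oflip c hc2 hvT hvflip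
  refine ⟨?_, by rw [hdev2, hdev1], ?_, ?_⟩
  · rw [rt_oflipCM, rt_oflipCM, rt_inv_eq_self_of_rt_eq hΨ, inv_inv, mul_assoc, inv_mul_cancel_right, inv_mul_cancel_right, oflipCM_cmul]
  · rw [fib_zero_sdiff_eq_filter hw hk hk2 hc2 hwc, hdev2, hdev1, filter_erase, filter_erase, erase_eq_of_notMem, card_erase_of_mem,
      ← fib_zero_sdiff_eq_filter hw hk hk2 hc2 hwc, hb]
    · have : 1 ≤ ((univ.filter fun s : G => w s = 0) \ Ψ.1).card :=
        card_pos.mpr ⟨t' * g⁻¹, mem_sdiff.mpr ⟨mem_filter.mpr ⟨mem_univ _, hb'⟩, hb'Ψ⟩⟩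
      omega
    · exact mem_filter.mpr ⟨mem_sdiff.mpr ⟨hb'T, hb'Ψ⟩, hb'⟩
    · rw [mem_erase, mem_filter]; rintro ⟨-, -, h⟩; rw [hv1] at h; exact one_ne_zero h
  · rw [fib_one_sdiff_eq_filter hw hk hk2 hc2 hwc, hdev2, hdev1, filter_erase, filter_erase, card_erase_of_mem, erase_eq_of_notMem,
      ← fib_one_sdiff_eq_filter hw hk hk2 hc2 hwc, hv]
    · have : 1 ≤ ((univ.filter fun s : G => w s = 1) \ Ψ.1).card :=
        card_pos.mpr ⟨t', mem_sdiff.mpr ⟨mem_filter.mpr ⟨mem_univ _, ht'1⟩, ht'Ψ⟩⟩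
      omega
    · rw [mem_filter]; rintro ⟨-, h⟩; rw [hb'] at h; exact one_ne_zero h.symm
    · exact mem_erase.mpr ⟨hne, mem_filter.mpr ⟨mem_sdiff.mpr ⟨hvT, hvΨ⟩, hv1⟩⟩

/-! ## §4 The elements and the reindexing bijections of the relation -/

omit [Fintype G] [DecidableEq G] in
/-- **`ν = c·g⁻¹·g⁻¹` lies in the kernel, `g⁻¹·g⁻¹ = c·ν`, and `b'·ν⁻¹ = s_{t'}`** (`k = 2`, `w g = 1`). [folklore] -/
theorem nu_spec (hw : ∀ P Q : G, w (P * Q) = w P + w Q) (hk : 1 ≤ k) (hk2 : k = 2) (hc2 : c * c = 1) (hcen : ∀ x : G, x * c = c * x)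
    (hwc : w c ≠ 0) {g : G} (hg : w g = 1) (t' : G) :
    w (c * g⁻¹ * g⁻¹) = 0 ∧ g⁻¹ * g⁻¹ = c * (c * g⁻¹ * g⁻¹) ∧ t' * g⁻¹ * (c * g⁻¹ * g⁻¹)⁻¹ = c * (t' * g) := by
  refine ⟨?_, by rw [← mul_assoc, ← mul_assoc, hc2, one_mul], ?_⟩
  · rw [hw, hw, map_inv hw, apply_c_eq_two hw hk hk2 hc2 hwc, hg]; subst hk2; decide
  · rw [mul_inv_rev, mul_inv_rev, inv_inv, inv_eq_of_mul_eq_one_right hc2, ← hcen (t' * g)]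
    simp only [mul_assoc, inv_mul_cancel_left]

/-- **`B·g = V`**: right multiplication by `g` carries the bottom deviation `F_0 ∖ Ψ` onto the top deviation `F_1 ∖ Ψ`. [folklore] -/
theorem image_bottom_mul_eq_top (hw : ∀ P Q : G, w (P * Q) = w P + w Q) {Ψ : CMF G c} {g : G} (hΨ : rt c g Ψ = Ψ) (hg : w g = 1) :
    ((univ.filter fun s : G => w s = 0) \ Ψ.1).image (fun q => q * g) = (univ.filter fun s : G => w s = 1) \ Ψ.1 := by
  ext p
  rw [mem_image, mem_sdiff, mem_filter]
  constructor
  · rintro ⟨q, hq, rfl⟩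
    rw [mem_sdiff, mem_filter] at hq
    exact ⟨⟨mem_univ _, by rw [hw, hq.1.2, hg, zero_add]⟩, fun h => hq.2 ((mem_iff_mul_mem_of_rt_eq hΨ q).mpr h)⟩
  · rintro ⟨⟨-, hp⟩, hpΨ⟩
    refine ⟨p * g⁻¹, mem_sdiff.mpr ⟨mem_filter.mpr ⟨mem_univ _, by rw [hw, map_inv hw, hp, hg, add_neg_cancel]⟩, fun h => hpΨ ?_⟩,
      inv_mul_cancel_right p g⟩
    exact (mul_inv_mem_iff_of_rt_eq hΨ p).mp h

/-- **`c·(V ∖ t')·g = (F_0 ∩ Ψ) ∖ s_{t'} = F_0 ∖ (B ∪ {s_{t'}})`**: the second reindexing bijection (`k = 2`). [folklore] -/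
theorem image_top_erase_eq (hw : ∀ P Q : G, w (P * Q) = w P + w Q) (hk : 1 ≤ k) (hk2 : k = 2) (hc2 : c * c = 1) (hwc : w c ≠ 0)
    {Ψ : CMF G c} {g : G} (hΨ : rt c g Ψ = Ψ) (hg : w g = 1) {t' : G} (ht'1 : w t' = 1) :
    (((univ.filter fun s : G => w s = 1) \ Ψ.1).erase t').image (fun q => c * (q * g)) =
      (univ.filter fun s : G => w s = 0) \ insert (c * (t' * g)) ((univ.filter fun s : G => w s = 0) \ Ψ.1) := by
  have h11 : (1 : ZMod (2 ^ k)) + 1 = 2 := by subst hk2; decide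
  have hwq : ∀ q : G, w q = 1 → w (c * (q * g)) = 0 := fun q hq => by
    rw [hw, hw, apply_c_eq_two hw hk hk2 hc2 hwc, hq, hg]; subst hk2; decide
  ext p
  rw [mem_image, mem_sdiff, mem_insert, mem_sdiff, mem_filter]
  constructor
  · rintro ⟨q, hq, rfl⟩
    rw [mem_erase, mem_sdiff, mem_filter] at hq
    obtain ⟨hqt, ⟨-, hq1⟩, hqΨ⟩ := hq
    refine ⟨⟨mem_univ _, hwq q hq1⟩, ?_⟩
    rintro (h | ⟨-, h⟩)
    · exact hqt (mul_right_cancel (mul_left_cancel h))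
    · exact h ((cmul_mem_iff Ψ _).mpr fun h' => hqΨ ((mem_iff_mul_mem_of_rt_eq hΨ q).mpr h'))
  · rintro ⟨⟨-, hp0⟩, hp⟩
    have hpΨ : p ∈ Ψ.1 := by by_contra h; exact hp (Or.inr ⟨⟨mem_univ _, hp0⟩, h⟩)
    refine ⟨c * (p * g⁻¹), mem_erase.mpr ⟨fun h => hp (Or.inl ?_), mem_sdiff.mpr ⟨mem_filter.mpr ⟨mem_univ _, ?_⟩, fun h => ?_⟩⟩, ?_⟩
    · rw [← h, mul_assoc, inv_mul_cancel_right, ← mul_assoc, hc2, one_mul]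
    · rw [hw, hw, map_inv hw, apply_c_eq_two hw hk hk2 hc2 hwc, hp0, hg]; subst hk2; decide
    · exact ((cmul_mem_iff Ψ _).mp h) ((mul_inv_mem_iff_of_rt_eq hΨ p).mpr hpΨ)
    · rw [mul_assoc, inv_mul_cancel_right, ← mul_assoc, hc2, one_mul]

end

end Summit.HodgeConjecture.CorCM.Census.CyclicCharacter
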